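import Summits.Ventures.HodgeRepro2.T5CyclotomicSevenDegreeOnePrime
import Summits.Ventures.HodgeRepro2.T5RecordSatakeSevenPrime

/-!
# The record's spherical Hecke algebra on the FIELD OF RECORD `ℚ(ζ₇)` at every DEGREE-ONE inert place: `q = p`,
# `p ≡ 6 (mod 7)`

Tier-5 support N3 / §G-N4.2 (seat p3, gen 79). File 264 shows that for every rational prime `p` of order `2` modulo
`7` (`p ≡ 6 (mod 7)`: `13, 41, 83, 97, …`) every place `v` of `ℚ(ζ₇)⁺` above `p` has residue cardinality `N(v) = p`
and stays prime in the sextic Galois CM field of record `ℚ(ζ₇)`. This file reads the Satake chain of the record's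
own pair (files 233 / 236 / 245 / 248 / 251) at every such place, with the Gram matrix `H₀ = diag(1, 1, −1)` of file
237 — file 257 (`q = p³`) with `q = p` THE PRIME ITSELF, the first places of the field of record where the Satake
parameters live over the prime field `𝔽_p` of the residue field:

* **`heckeAlgebra_mul_comm_record_seven_degree_one`**, **`nonempty_algEquiv_polynomial_record_seven_degree_one`**
  — `H(U(1 ⊗ H₀), K_v)` is commutative and `≃ k[X]` for every family `l` of generators and every field `k`;
* **`exists_doubleCosetOp_aeval_bijective_and_ncard_record_seven_degree_one`** — the generator
  `T₁ = 1_{K_v g₀ K_v}` has `deg T₁ = p⁴ + p = q⁴ + q`;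
* **`exists_cells_ncard_and_three_term_record_seven_degree_one`** — cells `gₙ` with `deg Tₙ = (p³ + 1) p^{4n−3}`
  (`n ≥ 1`), `deg T₀ = 1`, `T₁ T_{n+2} = T_{n+3} + (p − 1) T_{n+2} + p⁴ T_{n+1}` and
  `T₁² = T₂ + (p − 1) T₁ + (p⁴ + p) T₀` (`k` of characteristic `0`);
* the instance `p = 13` (`q = 13`) at every place of `ℚ(ζ₇)⁺` above `13`:
  `exists_doubleCosetOp_aeval_bijective_and_ncard_record_seven_thirteen` (`deg T₁ = 28574`),
  `exists_cells_three_term_record_seven_thirteen` (the recursion with `12`, `28561`, `28574`).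

§8(d): uses an L-value-free non-vanishing device: NO.
-/

open Matrix NumberField NumberField.IsCMField IsDedekindDomain IsDedekindDomain.HeightOneSpectrum Module Polynomial
  MulAction
open scoped TensorProduct Pointwise
open Summit.Ventures.HodgeRepro2.T5UnitaryGroupForm Summit.Ventures.HodgeRepro2.T5UnitaryHeckeAdjoint
  Summit.Ventures.HodgeRepro2.T5HeckePermutationModule Summit.Ventures.HodgeRepro2.T5HeckeDoubleCoset
  Summit.Ventures.HodgeRepro2.T5RecordHyperspecial Summit.Ventures.HodgeRepro2.T5GlobalLatticeAlmostAll
  Summit.Ventures.HodgeRepro2.T5FinitePlaceSplitClassification Summit.Ventures.HodgeRepro2.T5RecordSatakeIntrinsic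
  Summit.Ventures.HodgeRepro2.T5CMFieldSquareDatum Summit.Ventures.HodgeRepro2.T5RecordSatakeToy
  Summit.Ventures.HodgeRepro2.T5RecordSatakeDegreeIntrinsic
  Summit.Ventures.HodgeRepro2.T5RecordSatakeRecurrenceIntrinsic
  Summit.Ventures.HodgeRepro2.T5SplitPlaceUnitaryGroup Summit.Ventures.HodgeRepro2.T5NonSplitPlaceUnitaryGroup
  Summit.Ventures.HodgeRepro2.T5FinitePlaceCM Summit.Ventures.HodgeRepro2.T5StarOfInvolution
  Summit.Ventures.HodgeRepro2.T5RecordSatake Summit.Ventures.HodgeRepro2.T5RecordSatakeInert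
  Summit.Ventures.HodgeRepro2.T5RecordSatakeCell Summit.Ventures.HodgeRepro2.T5RecordSatakeDegree
  Summit.Ventures.HodgeRepro2.T5RecordSatakeRecurrence Summit.Ventures.HodgeRepro2.T5RecordSatakeInertToyDegree
  Summit.Ventures.HodgeRepro2.T5RecordSatakeDegreeCells Summit.Ventures.HodgeRepro2.T5CyclotomicSevenInertThree
  Summit.Ventures.HodgeRepro2.T5CyclotomicSevenInertPrime Summit.Ventures.HodgeRepro2.T5CyclotomicSevenDegreeOnePrime

namespace Summit.Ventures.HodgeRepro2.T5RecordSatakeSevenDegreeOne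

section Record

variable (K : Type*) [Field K] [CharZero K] [IsCyclotomicExtension {7} ℚ K]
variable (p : ℕ) [hp : Fact p.Prime] (h2 : orderOf (p : ZMod 7) = 2)
variable (v : HeightOneSpectrum (𝓞 (maximalRealSubfield K))) [hv : v.asIdeal.LiesOver (Ideal.span {(p : ℤ)})]

include h2 in
/-- **THE RECORD'S SPHERICAL HECKE ALGEBRA ON `ℚ(ζ₇)` AT EVERY DEGREE-ONE INERT PLACE IS COMMUTATIVE** (file 236's
`heckeAlgebra_mul_comm_record_of_staysPrime` with `hmap := map_eq`, `H := H₀`). -/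
theorem heckeAlgebra_mul_comm_record_seven_degree_one (k : Type*) [Field k] {r : ℕ} (l : Fin r → 𝓞 K)
    (hl : Submodule.span (𝓞 (maximalRealSubfield K)) (Set.range l) = ⊤)
    (T S : (haveI := numberField' K; haveI := isCMField' K; letI := tensorStarRing K v;
      ↥(heckeAlgebra k (recordHyperspecial K v l (gramToy K))))) :
    T * S = S * T :=
  haveI := numberField' K
  haveI := isCMField' K
  (exists_liesOver_and_map_eq K p h2 v).elim fun w h =>
    @T5RecordSatakeIntrinsic.heckeAlgebra_mul_comm_record_of_staysPrime K _ (numberField' K) (isCMField' K) v w h.1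
      _ l k _ hl h.2 _ gramToy_isHermitian isUnit_det_gramToy (notMem_badSet_gramToy _) T S

include h2 in
/-- **THE RECORD'S SPHERICAL HECKE ALGEBRA ON `ℚ(ζ₇)` AT EVERY DEGREE-ONE INERT PLACE IS `k[X]`** (file 236's
`nonempty_algEquiv_polynomial_record_of_staysPrime`). -/
theorem nonempty_algEquiv_polynomial_record_seven_degree_one (k : Type*) [Field k] {r : ℕ} (l : Fin r → 𝓞 K)
    (hl : Submodule.span (𝓞 (maximalRealSubfield K)) (Set.range l) = ⊤) :
    haveI := numberField' K; haveI := isCMField' K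
    Nonempty (Polynomial k ≃ₐ[k]
      (letI := tensorStarRing K v; ↥(heckeAlgebra k (recordHyperspecial K v l (gramToy K))))) :=
  haveI := numberField' K
  haveI := isCMField' K
  (exists_liesOver_and_map_eq K p h2 v).elim fun w h =>
    @T5RecordSatakeIntrinsic.nonempty_algEquiv_polynomial_record_of_staysPrime K _ (numberField' K) (isCMField' K)
      v w h.1 _ l k _ hl h.2 _ gramToy_isHermitian isUnit_det_gramToy (notMem_badSet_gramToy _)

include h2 in
/-- **`deg T₁ = p⁴ + p` AT EVERY DEGREE-ONE INERT PLACE `v` OF `ℚ(ζ₇)`** (file 245's datum-free generator with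
`(N(v)³ + 1) · N(v) = (p³ + 1) p = q⁴ + q`, `q = p`): for every family `l` of generators of `𝓞_{ℚ(ζ₇)}` over
`𝓞_{ℚ(ζ₇)⁺}` and every field `k`, some `g₀ ∈ U(1 ⊗ H₀)` has a double coset `K_v g₀ K_v` of exactly `p⁴ + p` left
cosets whose characteristic function `T₁` generates `H(U(1 ⊗ H₀), K_v)`. -/
theorem exists_doubleCosetOp_aeval_bijective_and_ncard_record_seven_degree_one (k : Type*) [Field k] {r : ℕ}
    (l : Fin r → 𝓞 K) (hl : Submodule.span (𝓞 (maximalRealSubfield K)) (Set.range l) = ⊤) :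
    haveI := numberField' K; haveI := isCMField' K
    ∃ g₀ : (letI := tensorStarRing K v; ↥(formUnitaryGroup (tensorGram K v (gramToy K)))),
      (orbit (recordHyperspecial K v l (gramToy K))
        (g₀ : _ ⧸ recordHyperspecial K v l (gramToy K))).ncard = p ^ 4 + p ∧
      ∃ _ : Finite (orbit (recordHyperspecial K v l (gramToy K))
          (g₀ : _ ⧸ recordHyperspecial K v l (gramToy K))),
        Function.Bijective (aeval (doubleCosetOp k (recordHyperspecial K v l (gramToy K)) g₀) :
          k[X] →ₐ[k] heckeAlgebra k (recordHyperspecial K v l (gramToy K))) := by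
  haveI := numberField' K
  haveI := isCMField' K
  refine (exists_liesOver_and_map_eq K p h2 v).elim fun w h => ?_
  have key := @exists_doubleCosetOp_aeval_bijective_and_ncard_record_of_staysPrime K _ (numberField' K)
    (isCMField' K) v w h.1 h.2 _ l k _ hl _ gramToy_isHermitian isUnit_det_gramToy (notMem_badSet_gramToy _)
  obtain ⟨g₀, hn, hb⟩ := key
  exact ⟨g₀, hn.trans (by rw [absNorm_eq K p h2 v]; ring), hb⟩

include h2 in
/-- **THE DEGREES OF ALL THE CELLS AND THE TREE RECURSION AT EVERY DEGREE-ONE INERT PLACE `v` OF `ℚ(ζ₇)`, `q = p`**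
(file 251's datum-free theorem with `N(v) = p`): for every family `l` of generators of `𝓞_{ℚ(ζ₇)}` over
`𝓞_{ℚ(ζ₇)⁺}` and every field `k` of characteristic `0`, cells `gₙ ∈ U(1 ⊗ H₀)` with
`#(K_v gₙ K_v / K_v) = (p³ + 1) p^{4n−3}` (`n ≥ 1`), `#(K_v g₀ K_v / K_v) = 1`, and `Tₙ := 1_{K_v gₙ K_v}` satisfying
`T₁ T_{n+2} = T_{n+3} + (p − 1) T_{n+2} + p⁴ T_{n+1}` and `T₁² = T₂ + (p − 1) T₁ + (p⁴ + p) T₀`. -/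
theorem exists_cells_ncard_and_three_term_record_seven_degree_one (k : Type*) [Field k] [CharZero k] {r : ℕ}
    (l : Fin r → 𝓞 K) (hl : Submodule.span (𝓞 (maximalRealSubfield K)) (Set.range l) = ⊤) :
    haveI := numberField' K; haveI := isCMField' K
    ∃ g : ℕ → (letI := tensorStarRing K v; ↥(formUnitaryGroup (tensorGram K v (gramToy K)))),
      (∀ n, 1 ≤ n → (orbit (recordHyperspecial K v l (gramToy K))
        (g n : _ ⧸ recordHyperspecial K v l (gramToy K))).ncard = (p ^ 3 + 1) * p ^ (4 * n - 3)) ∧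
      (orbit (recordHyperspecial K v l (gramToy K))
        (g 0 : _ ⧸ recordHyperspecial K v l (gramToy K))).ncard = 1 ∧
      ∃ hfin : ∀ n, Finite (orbit (recordHyperspecial K v l (gramToy K))
          (g n : _ ⧸ recordHyperspecial K v l (gramToy K))),
        (∀ n, letI := hfin 1; letI := hfin (n + 1 + 1); letI := hfin (n + 1 + 1 + 1); letI := hfin (n + 1);
          doubleCosetOp k (recordHyperspecial K v l (gramToy K)) (g 1) *
              doubleCosetOp k (recordHyperspecial K v l (gramToy K)) (g (n + 1 + 1)) =
            doubleCosetOp k (recordHyperspecial K v l (gramToy K)) (g (n + 1 + 1 + 1)) +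
              ((p : k) - 1) • doubleCosetOp k (recordHyperspecial K v l (gramToy K)) (g (n + 1 + 1)) +
              (p : k) ^ 4 • doubleCosetOp k (recordHyperspecial K v l (gramToy K)) (g (n + 1))) ∧
        (letI := hfin 1; letI := hfin (0 + 1); letI := hfin (0 + 1 + 1); letI := hfin 0;
          doubleCosetOp k (recordHyperspecial K v l (gramToy K)) (g 1) *
              doubleCosetOp k (recordHyperspecial K v l (gramToy K)) (g (0 + 1)) =
            doubleCosetOp k (recordHyperspecial K v l (gramToy K)) (g (0 + 1 + 1)) +
              ((p : k) - 1) • doubleCosetOp k (recordHyperspecial K v l (gramToy K)) (g (0 + 1)) +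
              ((p : k) ^ 4 + (p : k)) • doubleCosetOp k (recordHyperspecial K v l (gramToy K)) (g 0)) := by
  haveI := numberField' K
  haveI := isCMField' K
  refine (exists_liesOver_and_map_eq K p h2 v).elim fun w h => ?_
  have e1 : ((Ideal.absNorm v.asIdeal : k) - 1) = (p : k) - 1 := by
    rw [absNorm_eq K p h2 v]
  have e2 : (Ideal.absNorm v.asIdeal : k) ^ 4 = (p : k) ^ 4 := by
    rw [absNorm_eq K p h2 v]
  have e3 : (Ideal.absNorm v.asIdeal : k) ^ 4 + Ideal.absNorm v.asIdeal = (p : k) ^ 4 + (p : k) := by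
    rw [absNorm_eq K p h2 v]
  have key := @exists_cells_three_term_and_ncard_record_of_staysPrime' K _ (numberField' K) (isCMField' K)
    v w h.1 h.2 _ l k _ _ hl _ gramToy_isHermitian isUnit_det_gramToy (notMem_badSet_gramToy _)
  obtain ⟨g, hdeg, hdeg0, hfin, h1, h2'⟩ := key
  exact ⟨g, fun n hn => (hdeg n hn).trans (by rw [absNorm_eq K p h2 v]), hdeg0, hfin,
    fun n => three_term_congr e1 e2 (h1 n), three_term_congr e1 e3 h2'⟩

end Record

section Thirteen

variable (K : Type*) [Field K] [CharZero K] [IsCyclotomicExtension {7} ℚ K]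
variable (v : HeightOneSpectrum (𝓞 (maximalRealSubfield K))) [hv : v.asIdeal.LiesOver (Ideal.span {(13 : ℤ)})]

omit [CharZero K] [IsCyclotomicExtension {7} ℚ K] hv in
/-- The `LiesOver` hypothesis in the cast form used by the generic theorems. -/
theorem liesOver_natCast_thirteen (hv : v.asIdeal.LiesOver (Ideal.span {(13 : ℤ)})) :
    v.asIdeal.LiesOver (Ideal.span {((13 : ℕ) : ℤ)}) := by
  rwa [Nat.cast_ofNat]

/-- **THE GENERATOR AT EVERY PLACE ABOVE `13` ON `ℚ(ζ₇)`: `deg T₁ = 13⁴ + 13 = 28574`.** -/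
theorem exists_doubleCosetOp_aeval_bijective_and_ncard_record_seven_thirteen (k : Type*) [Field k] {r : ℕ}
    (l : Fin r → 𝓞 K) (hl : Submodule.span (𝓞 (maximalRealSubfield K)) (Set.range l) = ⊤) :
    haveI := numberField' K; haveI := isCMField' K
    ∃ g₀ : (letI := tensorStarRing K v; ↥(formUnitaryGroup (tensorGram K v (gramToy K)))),
      (orbit (recordHyperspecial K v l (gramToy K))
        (g₀ : _ ⧸ recordHyperspecial K v l (gramToy K))).ncard = 28574 ∧
      ∃ _ : Finite (orbit (recordHyperspecial K v l (gramToy K))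
          (g₀ : _ ⧸ recordHyperspecial K v l (gramToy K))),
        Function.Bijective (aeval (doubleCosetOp k (recordHyperspecial K v l (gramToy K)) g₀) :
          k[X] →ₐ[k] heckeAlgebra k (recordHyperspecial K v l (gramToy K))) :=
  haveI := numberField' K
  haveI := isCMField' K
  haveI := fact_prime_thirteen
  (exists_doubleCosetOp_aeval_bijective_and_ncard_record_seven_degree_one K 13 (hp := fact_prime_thirteen)
    orderOf_natCast_thirteen_zmod_seven v (hv := liesOver_natCast_thirteen K v hv) k l hl).elim fun g₀ h =>
    h.elim fun h1 h2 => ⟨g₀, h1.trans (by norm_num), h2⟩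

/-- **THE TREE RECURSION AT EVERY PLACE ABOVE `13` ON `ℚ(ζ₇)`, AS NUMERALS**:
`T₁ T_{n+2} = T_{n+3} + 12 T_{n+2} + 28561 T_{n+1}` and `T₁² = T₂ + 12 T₁ + 28574 T₀`. -/
theorem exists_cells_three_term_record_seven_thirteen (k : Type*) [Field k] [CharZero k] {r : ℕ}
    (l : Fin r → 𝓞 K) (hl : Submodule.span (𝓞 (maximalRealSubfield K)) (Set.range l) = ⊤) :
    haveI := numberField' K; haveI := isCMField' K
    ∃ g : ℕ → (letI := tensorStarRing K v; ↥(formUnitaryGroup (tensorGram K v (gramToy K)))),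
      ∃ hfin : ∀ n, Finite (orbit (recordHyperspecial K v l (gramToy K))
          (g n : _ ⧸ recordHyperspecial K v l (gramToy K))),
        (∀ n, letI := hfin 1; letI := hfin (n + 1 + 1); letI := hfin (n + 1 + 1 + 1); letI := hfin (n + 1);
          doubleCosetOp k (recordHyperspecial K v l (gramToy K)) (g 1) *
              doubleCosetOp k (recordHyperspecial K v l (gramToy K)) (g (n + 1 + 1)) =
            doubleCosetOp k (recordHyperspecial K v l (gramToy K)) (g (n + 1 + 1 + 1)) +
              (12 : k) • doubleCosetOp k (recordHyperspecial K v l (gramToy K)) (g (n + 1 + 1)) +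
              (28561 : k) • doubleCosetOp k (recordHyperspecial K v l (gramToy K)) (g (n + 1))) ∧
        (letI := hfin 1; letI := hfin (0 + 1); letI := hfin (0 + 1 + 1); letI := hfin 0;
          doubleCosetOp k (recordHyperspecial K v l (gramToy K)) (g 1) *
              doubleCosetOp k (recordHyperspecial K v l (gramToy K)) (g (0 + 1)) =
            doubleCosetOp k (recordHyperspecial K v l (gramToy K)) (g (0 + 1 + 1)) +
              (12 : k) • doubleCosetOp k (recordHyperspecial K v l (gramToy K)) (g (0 + 1)) +
              (28574 : k) • doubleCosetOp k (recordHyperspecial K v l (gramToy K)) (g 0)) := by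
  haveI := numberField' K
  haveI := isCMField' K
  haveI := fact_prime_thirteen
  have e1 : (((13 : ℕ) : k) - 1) = 12 := by norm_num
  have e2 : ((13 : ℕ) : k) ^ 4 = 28561 := by norm_num
  have e3 : ((13 : ℕ) : k) ^ 4 + ((13 : ℕ) : k) = 28574 := by norm_num
  have key := exists_cells_ncard_and_three_term_record_seven_degree_one K 13 (hp := fact_prime_thirteen)
    orderOf_natCast_thirteen_zmod_seven v (hv := liesOver_natCast_thirteen K v hv) k l hl
  obtain ⟨g, _, _, hfin, h1, h2⟩ := key
  exact ⟨g, hfin, fun n => three_term_congr e1 e2 (h1 n), three_term_congr e1 e3 h2⟩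

end Thirteen

end Summit.Ventures.HodgeRepro2.T5RecordSatakeSevenDegreeOne
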